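import Summits.KontsevichZagierPeriods.Zeta5Search.LaiSweepShard

/-!
# `κ₃` sweep certificate — shard file 115 of 127 (shards 805–811 of 889)

HONEST FRAMING. Systematic search; no irrationality claim unless certified. This file only checks,
by `decide +kernel`, shards 805–811 of the order-cell sweep of the `κ₃` point `(74, 2180, 444; δ74)`
(engine `LaiSweepEngine`, soundness `LaiSweepJump/Free/Eval/Shard/Kappa3`; a shard is `⟨regime, n,
p, q, p', q', Lo, Up⟩`: `n` cells from `p/q` to `p'/q'` with integer rate sums in `[Lo, Up]`, `K =
128`, `D = 2^40`). It draws NO conclusion: only the capstone `LaiKappa3SweepCert`, which needs all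
127 shard files, does. Kernel cost of this file ≈ 560 cells × 0.3 s.
-/

namespace Summit.KontsevichZagierPeriods.Zeta5Search.Sweep

set_option maxHeartbeats 100000000 in
/-- Shard 805: 80 cells of regime B from `332/371` to `388/433`.
[cite: Lai2024BallRivoal, §4 Lemma 4.3] -/
theorem shard805 :
    Shard.check 128 (2^40)
      ⟨true, 80, 332, 371, 388, 433, 9974008383681, 16786437137814⟩ = true := by
  decide +kernel

set_option maxHeartbeats 100000000 in
/-- Shard 806: 80 cells of regime B from `388/433` to `201/224`.
[cite: Lai2024BallRivoal, §4 Lemma 4.3] -/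
theorem shard806 :
    Shard.check 128 (2^40)
      ⟨true, 80, 388, 433, 201, 224, 10402716959108, 17525642537567⟩ = true := by
  decide +kernel

set_option maxHeartbeats 100000000 in
/-- Shard 807: 80 cells of regime B from `201/224` to `195/217`.
[cite: Lai2024BallRivoal, §4 Lemma 4.3] -/
theorem shard807 :
    Shard.check 128 (2^40)
      ⟨true, 80, 201, 224, 195, 217, 10802936133957, 18218982812510⟩ = true := by
  decide +kernel

set_option maxHeartbeats 100000000 in
/-- Shard 808: 80 cells of regime B from `195/217` to `332/369`.
[cite: Lai2024BallRivoal, §4 Lemma 4.3] -/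
theorem shard808 :
    Shard.check 128 (2^40)
      ⟨true, 80, 195, 217, 332, 369, 9253310626257, 15621011433234⟩ = true := by
  decide +kernel

set_option maxHeartbeats 100000000 in
/-- Shard 809: 80 cells of regime B from `332/369` to `237/263`.
[cite: Lai2024BallRivoal, §4 Lemma 4.3] -/
theorem shard809 :
    Shard.check 128 (2^40)
      ⟨true, 80, 332, 369, 237, 263, 11739181860126, 19838422057872⟩ = true := by
  decide +kernel

set_option maxHeartbeats 100000000 in
/-- Shard 810: 80 cells of regime B from `237/263` to `268/297`.
[cite: Lai2024BallRivoal, §4 Lemma 4.3] -/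
theorem shard810 :
    Shard.check 128 (2^40)
      ⟨true, 80, 237, 263, 268, 297, 10111535381309, 17106108338913⟩ = true := by
  decide +kernel

set_option maxHeartbeats 100000000 in
/-- Shard 811: 80 cells of regime B from `268/297` to `4341/4804`.
[cite: Lai2024BallRivoal, §4 Lemma 4.3] -/
theorem shard811 :
    Shard.check 128 (2^40)
      ⟨true, 80, 268, 297, 4341, 4804, 10513650907828, 17804600445835⟩ = true := by
  decide +kernel

/-- The checked shards of this file, in order. [folklore] -/
def shards115 : List (CheckedShard 128 (2^40)) :=
  [⟨_, shard805⟩, ⟨_, shard806⟩, ⟨_, shard807⟩, ⟨_, shard808⟩, ⟨_, shard809⟩,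
    ⟨_, shard810⟩, ⟨_, shard811⟩]

end Summit.KontsevichZagierPeriods.Zeta5Search.Sweep
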